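import Literature.Analysis.FluidPDE.PeriodicClassicalDescent
import Literature.Analysis.FluidPDE.OseenMildUniqueness
import Literature.Analysis.FluidPDE.NSBoundedMildSmoothing
import Literature.Analysis.FunctionSpaces.TorusClassicalNSRestart
import HarnessLib

/-!
# A periodic bounded solution of the Oseen integral equation on `(0, T]` is a classical solution
  on the torus

Analysis/FluidPDE support file (everything proved) for the perturbation step of M. P. Coiculescu,
S. Palasek, *Non-uniqueness of smooth solutions of the Navier–Stokes equations from critical data*,
Invent. Math. 244 (2025) = arXiv:2503.14699, §5 ¶1: "By standard regularity theory, `u⁽ⁱ⁾` is in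
fact smooth on `(0,1] × 𝕋³`." The input is a velocity `u` on `ℝ³`, jointly measurable, with
lattice-periodic weakly divergence-free slices, bounded on every `[s, T]`, `s > 0`, and solving
the Oseen integral equation `u(t) = e^{(t-s)Δ}u(s) - B¹_s(u,u)(t)` from every base `0 < s < t ≤ T`
(for `u = v + w` this is `add_nlLimit_eq_oseenMild`). The output is a pressure for which the
descended field `U(t)(x) = u(t)(repr x)` is a classical solution of Navier–Stokes on
`(0, T] × 𝕋³`. The standard regularity theory used is that of Koch–Nadirashvili–Seregin–Šverák as
formalised in the tree: from the bounded datum `u(s)` the whole-space theory produces a classical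
periodic solution on a window `(s, s + ε₀/M²)` (`exists_classical_of_bounded_data`), which
coincides with `u` by uniqueness of bounded Oseen-mild solutions (`oseenMild_bounded_unique`) and
descends to the torus (`Torus.exists_isClassicalNSSolutionOn_of_periodic`); the windows are
patched by locality (`Torus.IsClassicalNSSolutionOn.of_local`), the pressures being normalised at
a base point (`pressure_sub_eq_of_eventuallyEq`); the last window extends `u` beyond `T`, which
gives the one-sided smoothness at `t = T`.

* `continuous_slice_of_oseenMild` — slices of bounded Oseen-mild fields are continuous;
* `Torus.IsClassicalNSSolutionOn.congr_velocity'` — changing the velocity off... (equal on `S`);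
* `exists_torus_window_of_oseenMild` — the local classical window around each `t ∈ (0, T]`;
* `Torus.exists_isClassicalNSSolutionOn_of_oseenMild` — the classical solution on `(0, T]`.

## References

* M. P. Coiculescu, S. Palasek, Invent. Math. 244 (2025) = arXiv:2503.14699, §5 ¶1.
  [`CoiculescuPalasek2025`]
* G. Koch, N. Nadirashvili, G. Seregin, V. Šverák, Acta Math. 203 (2009) = arXiv:0709.3599, §4,
  Prop. 4.1 and p. 8. [`KochNadirashviliSereginSverak2009`]
-/

noncomputable section

open MeasureTheory Set Function Filter TopologicalSpace InnerProductSpace Metric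
open Literature.Analysis.FunctionSpaces
open _root_.Topology
open scoped RealInnerProductSpace NNReal ENNReal

namespace Literature.Analysis.FluidPDE

section General

variable {E : Type*} [NormedAddCommGroup E] [InnerProductSpace ℝ E] [FiniteDimensional ℝ E]
  [MeasurableSpace E] [BorelSpace E]

/-- **Slices of bounded Oseen-mild fields are continuous**: if `u` is jointly measurable,
bounded by `M` on `[s, t]`, `s < t`, and `u(t) = e^{(t-s)Δ}u(s) - B¹_s(u,u)(t)` everywhere, then
`u(t)` is continuous (the caloric extension of a bounded function and the Duhamel term of bounded
fields are continuous). [folklore] -/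
theorem continuous_slice_of_oseenMild {u : ℝ → E → E} (hum : Measurable (uncurry u)) {s t M : ℝ}
    (hst : s < t) (hbd : ∀ τ ∈ Icc s t, ∀ y, ‖u τ y‖ ≤ M)
    (hid : ∀ x, u t x = UnboundedOperators.heatExtension (u s) (t - s) x - oseenDuhamel 1 s u u t x) :
    Continuous (u t) := by
  haveI : CompleteSpace E := FiniteDimensional.complete ℝ E
  have hM : 0 ≤ M := (norm_nonneg _).trans (hbd s ⟨le_rfl, hst.le⟩ 0)
  have hfun : u t = fun x =>
      UnboundedOperators.heatExtension (u s) (t - s) x - oseenDuhamel 1 s u u t x := funext hid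
  rw [hfun]
  have hsl : AEStronglyMeasurable (u s) volume :=
    (hum.comp (measurable_const.prodMk measurable_id)).aestronglyMeasurable
  have h1 : Continuous (UnboundedOperators.heatExtension (u s) (t - s)) :=
    (UnboundedOperators.contDiff_heatExtension_holds
      (memLp_top_of_bound hsl M (Eventually.of_forall (hbd s ⟨le_rfl, hst.le⟩))) le_top
      (sub_pos.2 hst)).continuous
  have h2 : Continuous (oseenDuhamel 1 s u u t) := by
    have h := continuous_oseenDuhamel_slice (ν := 1) one_pos hM (s := s) (T := t)
      hum.aestronglyMeasurable.restrict hum.aestronglyMeasurable.restrict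
      (fun τ hτ y => hbd τ ⟨hτ.1.le, hτ.2.le⟩ y) (fun τ hτ y => hbd τ ⟨hτ.1.le, hτ.2.le⟩ y) hst le_rfl
    exact h
  exact h1.sub h2

end General

section Torus

variable {d : Type*} [Fintype d] [DecidableEq d]

/-- Changing the velocity to a field with the same slices on `S` keeps a classical solution on
the torus (all clauses only see the slices `u t`, `t ∈ S`). [folklore] -/
theorem _root_.Literature.Analysis.FunctionSpaces.Torus.IsClassicalNSSolutionOn.congr_velocity'
    {S : Set ℝ} {ν : ℝ} {f u u' : ℝ → UnitAddTorus d → EuclideanSpace ℝ d}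
    {p : ℝ → UnitAddTorus d → ℝ} (h : Torus.IsClassicalNSSolutionOn S ν f u p)
    (hu : ∀ t ∈ S, u' t = u t) : Torus.IsClassicalNSSolutionOn S ν f u' p where
  smooth_velocity := h.smooth_velocity.congr fun z hz => by
    obtain ⟨τ, y⟩ := z
    simp only [Torus.stLift_apply, hu τ (mem_prod.1 hz).1]
  smooth_pressure := h.smooth_pressure
  momentum t ht x := by
    have hD : Torus.timeDerivWithin S u' t x = Torus.timeDerivWithin S u t x := by
      simp only [Torus.timeDerivWithin]
      exact derivWithin_congr (fun τ hτ => by rw [hu τ hτ]) (by rw [hu t ht])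
    rw [hD, hu t ht]
    exact h.momentum t ht x
  divFree t ht := by rw [hu t ht]; exact h.divFree t ht

end Torus

/-! ### The local classical windows -/

section Window

/-- Local notation for physical space `ℝ³ = EuclideanSpace ℝ (Fin 3)`. -/
local notation "ℝ³" => EuclideanSpace ℝ (Fin 3)
/-- Local notation for the flat torus `𝕋³`. -/
local notation "𝕋³" => UnitAddTorus (Fin 3)

variable {T : ℝ} {u : ℝ → ℝ³ → ℝ³}

/-- **The local classical window around a time `t ∈ (0, T]`.** For a jointly measurable field
`u` with lattice-periodic weakly divergence-free slices, bounded on every `[s, T]` (`s > 0`) and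
Oseen-mild from every base (`u(t) = e^{(t-s)Δ}u(s) - B¹_s(u,u)(t)`, `0 < s < t ≤ T`), and every
`t ∈ (0, T]`, there are `0 < s < t < s + h` and a classical solution `(V, Θ)` of Navier–Stokes on the
torus on `(s, s + h)` with `V(τ) = u(τ) ∘ repr` for `τ ∈ (s, s + h)`, `τ ≤ T`: the whole-space
Koch–Nadirashvili–Seregin–Šverák solution from the datum `u(s)` (`exists_classical_of_bounded_data`),
identified with `u` by `oseenMild_bounded_unique`, and descended
(`Torus.exists_isClassicalNSSolutionOn_of_periodic`). [cite: KochNadirashviliSereginSverak2009, §4 Prop. 4.1 and p. 8 (arXiv:0709.3599v1); CoiculescuPalasek2025, §5 ¶1] -/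
theorem exists_torus_window_of_oseenMild (hum : Measurable (uncurry u))
    (hbd : ∀ s ∈ Ioo 0 T, ∃ M : ℝ, ∀ τ ∈ Icc s T, ∀ y, ‖u τ y‖ ≤ M)
    (hmild : ∀ ⦃s t : ℝ⦄, 0 < s → s < t → t ≤ T → ∀ x,
      u t x = UnboundedOperators.heatExtension (u s) (t - s) x - oseenDuhamel 1 s u u t x)
    (hper : ∀ t ∈ Ioc 0 T, Torus.IsLatticePeriodic (u t))
    (hdiv : ∀ s ∈ Ioo 0 T, IsWeaklyDivFree (u s)) {t : ℝ} (ht : t ∈ Ioc 0 T) :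
    ∃ (s h : ℝ) (V : ℝ → 𝕋³ → ℝ³) (Θ : ℝ → 𝕋³ → ℝ), 0 < s ∧ s < t ∧ t < s + h ∧
      Torus.IsClassicalNSSolutionOn (Ioo s (s + h)) 1 0 V Θ ∧
      ∀ τ, s < τ → τ < s + h → τ ≤ T → V τ = fun x => u τ (Torus.repr x) := by
  haveI : CompleteSpace ℝ³ := FiniteDimensional.complete ℝ _
  have hE : Module.finrank ℝ ℝ³ = 3 := finrank_euclideanSpace_fin
  have hT : 0 < T := ht.1.trans_le ht.2
  -- a uniform bound on `[t/2, T]`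
  have ht2 : t / 2 ∈ Ioo 0 T := ⟨by linarith [ht.1], by linarith [ht.2]⟩
  obtain ⟨M₀, hM₀⟩ := hbd (t / 2) ht2
  set M : ℝ := max M₀ 1 with hMdef
  have hM : 0 < M := lt_of_lt_of_le zero_lt_one (le_max_right _ _)
  have hbM : ∀ τ ∈ Icc (t / 2) T, ∀ y, ‖u τ y‖ ≤ M := fun τ hτ y =>
    (hM₀ τ hτ y).trans (le_max_left _ _)
  -- the local theory and the base time
  obtain ⟨ε₀, hε₀, C₀, hC₀, hloc⟩ := exists_classical_of_bounded_data (E := ℝ³) hE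
  set h : ℝ := ε₀ / M ^ 2 with hhdef
  have hh : 0 < h := by positivity
  set s : ℝ := max (t / 2) (t - h / 2) with hsdef
  have hs0 : 0 < s := lt_of_lt_of_le (by linarith [ht.1]) (le_max_left _ _)
  have hst : s < t := max_lt (by linarith [ht.1]) (by linarith)
  have hth : t < s + h := by
    have : t - h / 2 ≤ s := le_max_right _ _
    linarith
  have hsT : s < T := hst.trans_le ht.2
  have hs2 : t / 2 ≤ s := le_max_left _ _
  -- the datum
  set a : ℝ³ → ℝ³ := u s with hadef
  have ham : Measurable a := hum.comp (measurable_const.prodMk measurable_id)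
  have haM : ∀ y, ‖a y‖ ≤ M := fun y => hbM s ⟨hs2, hsT.le⟩ y
  obtain ⟨v, p, hcl, hvm, -, hveq, hvM, hvper⟩ := hloc hM ham (hdiv s ⟨hs0, hsT⟩) haM
  -- the shifted field and the uniqueness window
  set us : ℝ → ℝ³ → ℝ³ := fun τ => u (τ + s) with husdef
  set T' : ℝ := min h (T - s) with hT'def
  have hT' : 0 < T' := lt_min hh (sub_pos.2 hsT)
  have hC₀M : M ≤ C₀ * M := le_mul_of_one_le_left hM.le hC₀
  have husm : AEStronglyMeasurable (uncurry us)
      ((volume : Measure (ℝ × ℝ³)).restrict (Ioo 0 T' ×ˢ univ)) := by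
    have hm : Measurable (uncurry us) :=
      hum.comp ((measurable_fst.add_const s).prodMk measurable_snd)
    exact hm.aestronglyMeasurable.restrict
  have hvm' : AEStronglyMeasurable (uncurry v)
      ((volume : Measure (ℝ × ℝ³)).restrict (Ioo 0 T' ×ˢ univ)) := hvm.aestronglyMeasurable.restrict
  have husM : ∀ σ ∈ Ioo 0 T', ∀ y, ‖us σ y‖ ≤ C₀ * M := by
    intro σ hσ y
    have h1 : σ + s ∈ Icc (t / 2) T :=
      ⟨by linarith [hσ.1], by linarith [hσ.2, min_le_right h (T - s)]⟩
    exact (hbM _ h1 y).trans hC₀M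
  have hvM' : ∀ σ ∈ Ioo 0 T', ∀ y, ‖v σ y‖ ≤ C₀ * M := fun σ _ y => hvM σ y
  -- the Oseen identity of the shifted field from base `0`
  have hus_id : ∀ σ, 0 < σ → σ + s ≤ T → ∀ x,
      us σ x = UnboundedOperators.heatExtension a σ x - oseenDuhamel 1 0 us us σ x := by
    intro σ hσ hσT x
    have h1 := hmild hs0 (by linarith : s < σ + s) hσT x
    rw [add_sub_cancel_right] at h1
    have h2 := oseenDuhamel_translate 1 0 s u u σ x
    rw [zero_add] at h2
    simp only [husdef, hadef]
    rw [h1, ← h2]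
  have hu_ae : ∀ σ ∈ Ioo 0 T', us σ =ᵐ[volume] fun x =>
      UnboundedOperators.heatExtension a σ x - oseenDuhamel 1 0 us us σ x := fun σ hσ =>
    Eventually.of_forall (hus_id σ hσ.1 (by linarith [hσ.2, min_le_right h (T - s)]))
  have hv_ae : ∀ σ ∈ Ioo 0 T', v σ =ᵐ[volume] fun x =>
      UnboundedOperators.heatExtension a σ x - oseenDuhamel 1 0 v v σ x := fun σ hσ =>
    Eventually.of_forall fun x => hveq σ ⟨hσ.1, hσ.2.trans_le (min_le_left _ _)⟩ x
  have huniq := oseenMild_bounded_unique one_pos (by positivity : (0 : ℝ) ≤ C₀ * M) husm hvm'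
    husM hvM' hu_ae hv_ae
  -- identification everywhere, up to the endpoint
  have hident : ∀ τ, 0 < τ → τ < h → τ + s ≤ T → ∀ x, v τ x = us τ x := by
    intro τ hτ0 hτh hτT x
    have hB : oseenDuhamel 1 0 v v τ x = oseenDuhamel 1 0 us us τ x := by
      rw [oseenDuhamel_apply, oseenDuhamel_apply]
      refine setIntegral_congr_fun measurableSet_Ioo fun σ hσ => ?_
      refine integral_congr_ae ?_
      have hσT' : σ ∈ Ioo 0 T' := ⟨hσ.1, lt_min (hσ.2.trans hτh) (by linarith [hσ.2])⟩
      filter_upwards [huniq σ hσT'] with y hy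
      rw [hy]
    rw [hveq τ ⟨hτ0, hτh⟩ x, hB, ← hus_id τ hτ0 hτT x]
  -- periodicity of the local solution
  have hvperL : ∀ σ, Torus.IsLatticePeriodic (v σ) := by
    intro σ j y
    have hc : ∀ z, a (EuclideanSpace.single j (1 : ℝ) + z) = a z := fun z => by
      rw [add_comm]; exact hper s ⟨hs0, hsT.le⟩ j z
    rw [add_comm]
    exact hvper _ hc σ y
  -- continuity of the datum and the constancy of the means
  have ha_cont : Continuous a := by
    have hs' : s / 2 ∈ Ioo 0 T := ⟨by linarith, by linarith⟩
    obtain ⟨M₁, hM₁⟩ := hbd (s / 2) hs'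
    exact continuous_slice_of_oseenMild hum (by linarith : s / 2 < s)
      (fun τ hτ y => hM₁ τ ⟨hτ.1, hτ.2.trans hsT.le⟩ y)
      (fun x => hmild hs'.1 (by linarith : s / 2 < s) hsT.le x)
  set A : 𝕋³ → ℝ³ := fun x => a (Torus.repr x) with hAdef
  have hAlift : Torus.lift A = a := Torus.lift_descend_holds a (hper s ⟨hs0, hsT.le⟩)
  have hA_cont : Continuous A := Torus.continuous_lift_iff.1 (by rw [hAlift]; exact ha_cont)
  have hVσ_cont : ∀ σ ∈ Ioo 0 h, Continuous fun x : 𝕋³ => v σ (Torus.repr x) := by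
    intro σ hσ
    have h1 : Torus.lift (fun x : 𝕋³ => v σ (Torus.repr x)) = v σ :=
      Torus.lift_descend_holds (v σ) (hvperL σ)
    exact Torus.continuous_lift_iff.1 (by rw [h1]; exact (hcl.smooth_velocity.contDiff_slice hσ).continuous)
  have hmeanC : ∀ τ ∈ Ioo 0 h, ∫ x : 𝕋³, v τ (Torus.repr x) = ∫ x, A x := by
    intro τ hτ
    have hVt : (fun x : 𝕋³ => v τ (Torus.repr x)) = fun x =>
        UnboundedOperators.heatExtension (Torus.lift A) τ (Torus.repr x) -
          oseenDuhamel 1 0 v v τ (Torus.repr x) := by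
      funext x; rw [hAlift]; exact hveq τ hτ _
    have hi1 : Integrable (fun x : 𝕋³ =>
        UnboundedOperators.heatExtension (Torus.lift A) τ (Torus.repr x)) volume := by
      have hc : Continuous (UnboundedOperators.heatExtension (Torus.lift A) τ) :=
        (TorusHeat.contDiff_heatExtension_lift hA_cont hτ.1 (m := 0)).continuous
      refine (integrable_const M).mono' (hc.measurable.comp Torus.measurable_repr).aestronglyMeasurable
        (Eventually.of_forall fun x => ?_)
      rw [hAlift]
      exact UnboundedOperators.norm_heatExtension_le_of_bound haM hτ.1 _
    have hi2 : Integrable (fun x : 𝕋³ => oseenDuhamel 1 0 v v τ (Torus.repr x)) volume := by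
      have hi3 : Integrable (fun x : 𝕋³ => v τ (Torus.repr x)) volume :=
        (hVσ_cont τ hτ).integrable_unitAddTorus
      have he : (fun x : 𝕋³ => oseenDuhamel 1 0 v v τ (Torus.repr x)) = fun x =>
          UnboundedOperators.heatExtension (Torus.lift A) τ (Torus.repr x) - v τ (Torus.repr x) := by
        funext x
        have := hveq τ hτ (Torus.repr x)
        rw [hAlift, this, sub_sub_cancel]
      rw [he]
      exact hi1.sub hi3
    rw [hVt, integral_sub hi1 hi2, Torus.integral_heatExtension_lift_repr hA_cont hτ.1,
      Torus.integral_oseenDuhamel_repr_eq_zero (V := fun σ x => v σ (Torus.repr x)) one_pos hvm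
        (fun σ _ y => hvM σ y) (fun σ hσ => hVσ_cont σ ⟨hσ.1, hσ.2.trans hτ.2⟩)
        (fun σ _ => Torus.lift_descend_holds (v σ) (hvperL σ)), sub_zero]
  -- descend and shift to the base time `s`
  obtain ⟨Θ, hTcl⟩ := Torus.exists_isClassicalNSSolutionOn_of_periodic hcl hvperL hmeanC
  have hTs := hTcl.comp_add_const (-s)
  have hf0 : (fun τ : ℝ => (0 : ℝ → 𝕋³ → ℝ³) (τ + -s)) = 0 := rfl
  rw [preimage_add_const_Ioo, sub_neg_eq_add, sub_neg_eq_add, zero_add, add_comm h s, hf0] at hTs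
  refine ⟨s, h, fun τ x => v (τ + -s) (Torus.repr x), fun τ => Θ (τ + -s), hs0, hst, hth, hTs,
    fun τ hτs hτh hτT => funext fun x => ?_⟩
  have h1 := hident (τ + -s) (by linarith) (by linarith) (by linarith) (Torus.repr x)
  simp only [husdef, neg_add_cancel_right] at h1
  exact h1

/-- **A periodic bounded Oseen-mild field on `(0, T]` is a classical solution on the torus.** Let
`u : ℝ → ℝ³ → ℝ³` be jointly measurable, bounded on every `[s, T]`, `s ∈ (0, T)`, with
lattice-periodic slices on `(0, T]` and weakly divergence-free slices on `(0, T)`, and suppose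
`u(t)(x) = e^{(t-s)Δ}u(s)(x) - B¹_s(u,u)(t)(x)` for all `0 < s < t ≤ T` and all `x`. Then for some
pressure `q` the descended field `U(t)(x) = u(t)(repr x)` is a classical solution of the
Navier–Stokes equations (`ν = 1`, no force) on `(0, T] × 𝕋³` — "by standard regularity theory,
`u` is in fact smooth on `(0, 1] × 𝕋³`" (Coiculescu–Palasek, §5 ¶1), the standard theory being
Koch–Nadirashvili–Seregin–Šverák's (local windows `exists_torus_window_of_oseenMild`, patched by
`Torus.IsClassicalNSSolutionOn.of_local` with pressures normalised at a base point; the window at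
`t = T` extends the solution beyond `T`). [cite: CoiculescuPalasek2025, §5 ¶1; KochNadirashviliSereginSverak2009, §4 Prop. 4.1 and p. 8 (arXiv:0709.3599v1)] -/
theorem Torus.exists_isClassicalNSSolutionOn_of_oseenMild (hT : 0 < T) (hum : Measurable (uncurry u))
    (hbd : ∀ s ∈ Ioo 0 T, ∃ M : ℝ, ∀ τ ∈ Icc s T, ∀ y, ‖u τ y‖ ≤ M)
    (hmild : ∀ ⦃s t : ℝ⦄, 0 < s → s < t → t ≤ T → ∀ x,
      u t x = UnboundedOperators.heatExtension (u s) (t - s) x - oseenDuhamel 1 s u u t x)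
    (hper : ∀ t ∈ Ioc 0 T, Torus.IsLatticePeriodic (u t))
    (hdiv : ∀ s ∈ Ioo 0 T, IsWeaklyDivFree (u s)) :
    ∃ q : ℝ → 𝕋³ → ℝ,
      Torus.IsClassicalNSSolutionOn (Ioc 0 T) 1 0 (fun t x => u t (Torus.repr x)) q := by
  -- the windows, chosen once and for all
  have hwin := fun t (ht : t ∈ Ioc 0 T) => exists_torus_window_of_oseenMild hum hbd hmild hper hdiv ht
  choose! sf hf Vf Θf hspec using hwin
  set U : ℝ → 𝕋³ → ℝ³ := fun t x => u t (Torus.repr x) with hUdef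
  have hTmem : T ∈ Ioc 0 T := ⟨hT, le_rfl⟩
  obtain ⟨hsS0, hsST, hTS, hclS, hidS⟩ := hspec T hTmem
  -- the extended velocity and the canonical pressure
  set x₀ : 𝕋³ := 0 with hx₀
  set Tp : ℝ := sf T + hf T with hTp
  set Uext : ℝ → 𝕋³ → ℝ³ := fun t => if t ≤ T then U t else Vf T t with hUext
  set P : ℝ → 𝕋³ → ℝ := fun t x =>
    if sf T < t then Θf T t x - Θf T t x₀ else Θf t t x - Θf t t x₀ with hPdef
  have hUext_le : ∀ t, t ≤ T → Uext t = U t := fun t ht => by simp only [hUext, if_pos ht]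
  have hstar : ∀ t ∈ Ioo (sf T) Tp, Vf T t = Uext t := by
    intro t ht
    by_cases htT : t ≤ T
    · rw [hUext_le t htT]; exact hidS t ht.1 ht.2 htT
    · simp only [hUext, if_neg htT]
  -- local solutions with velocity `Uext` near every point
  have hlocal : ∀ t ∈ Ioo 0 Tp, ∃ O : Set ℝ, IsOpen O ∧ t ∈ O ∧ O ⊆ Ioo 0 Tp ∧
      ∃ (V : ℝ → 𝕋³ → ℝ³) (Θ : ℝ → 𝕋³ → ℝ),
        Torus.IsClassicalNSSolutionOn O 1 0 V Θ ∧ (∀ τ ∈ O, V τ = Uext τ) := by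
    intro t ht
    by_cases hts : sf T < t
    · refine ⟨Ioo (sf T) Tp, isOpen_Ioo, ⟨hts, ht.2⟩, Ioo_subset_Ioo_left hsS0.le, Vf T, Θf T,
        hclS, hstar⟩
    · have htT : t < T := (not_lt.1 hts).trans_lt hsST
      have htI : t ∈ Ioc 0 T := ⟨ht.1, htT.le⟩
      obtain ⟨hs0, hst, hth, hcl, hid⟩ := hspec t htI
      refine ⟨Ioo (sf t) (min (sf t + hf t) T), isOpen_Ioo, ⟨hst, lt_min hth htT⟩,
        fun τ hτ => ⟨hs0.trans hτ.1, (hτ.2.trans_le (min_le_right _ _)).trans hTS⟩, Vf t, Θf t,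
        hcl.mono (Ioo_subset_Ioo_right (min_le_left _ _)) isOpen_Ioo.uniqueDiffOn, ?_⟩
      · intro τ hτ
        have hτT : τ ≤ T := (hτ.2.trans_le (min_le_right _ _)).le
        rw [hUext_le τ hτT]
        exact hid τ hτ.1 (hτ.2.trans_le (min_le_left _ _)) hτT
  -- the canonical pressure agrees with every local normalised pressure
  have hP_eq : ∀ {O : Set ℝ} {V : ℝ → 𝕋³ → ℝ³} {Θ : ℝ → 𝕋³ → ℝ}, IsOpen O →
      Torus.IsClassicalNSSolutionOn O 1 0 V Θ → (∀ τ ∈ O, V τ = Uext τ) → O ⊆ Ioo 0 Tp →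
      ∀ τ ∈ O, (fun x => Θ τ x - Θ τ x₀) = P τ := by
    intro O V Θ hO hcl hV hOsub τ hτ
    funext x
    by_cases hτs : sf T < τ
    · -- compare with the `T`-window
      simp only [hPdef, if_pos hτs]
      have hτ' : τ ∈ Ioo (sf T) Tp := ⟨hτs, (hOsub hτ).2⟩
      refine hcl.pressure_sub_eq_of_eventuallyEq hclS (hO.mem_nhds hτ) (isOpen_Ioo.mem_nhds hτ') ?_ x x₀
      filter_upwards [hO.mem_nhds hτ, isOpen_Ioo.mem_nhds hτ'] with σ hσ hσ'
      rw [hV σ hσ, hstar σ hσ']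
    · -- compare with the own window of `τ`
      simp only [hPdef, if_neg hτs]
      have hτT : τ < T := (not_lt.1 hτs).trans_lt hsST
      have hτI : τ ∈ Ioc 0 T := ⟨(hOsub hτ).1, hτT.le⟩
      obtain ⟨hs0, hst, hth, hclτ, hidτ⟩ := hspec τ hτI
      have hW : τ ∈ Ioo (sf τ) (sf τ + hf τ) := ⟨hst, hth⟩
      refine hcl.pressure_sub_eq_of_eventuallyEq hclτ (hO.mem_nhds hτ) (isOpen_Ioo.mem_nhds hW) ?_ x x₀
      filter_upwards [hO.mem_nhds hτ, isOpen_Ioo.mem_nhds hW, Iio_mem_nhds hτT] with σ hσ hσW hσT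
      rw [hV σ hσ, hUext_le σ (le_of_lt hσT)]
      exact (hidτ σ hσW.1 hσW.2 (le_of_lt hσT)).symm
  -- patch
  have hglob : Torus.IsClassicalNSSolutionOn (Ioo 0 Tp) 1 0 Uext P := by
    refine Torus.IsClassicalNSSolutionOn.of_local isOpen_Ioo fun t ht => ?_
    obtain ⟨O, hO, htO, hOsub, V, Θ, hcl, hV⟩ := hlocal t ht
    exact ⟨O, hO, htO, hOsub, V, fun τ x => Θ τ x - Θ τ x₀, hcl.sub_pressure_apply x₀, hV,
      hP_eq hO hcl hV hOsub⟩
  -- restrict to `(0, T]`, where `Uext = U`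
  have hTTp : T < Tp := hTS
  have hres : Torus.IsClassicalNSSolutionOn (Ioc 0 T) 1 0 Uext P :=
    hglob.mono (fun τ hτ => ⟨hτ.1, hτ.2.trans_lt hTTp⟩) (uniqueDiffOn_Ioc 0 T)
  exact ⟨P, hres.congr_velocity' fun τ hτ => (hUext_le τ hτ.2).symm⟩

end Window

end Literature.Analysis.FluidPDE
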